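import Summits.BirchSwinnertonDyer.BirchSwinnertonDyer.Theorems.ManinLocalTwoThreeManinPrimeToAdditiveFiveLeRedFiveSevenStarredOfItems
import Summits.BirchSwinnertonDyer.BirchSwinnertonDyer.Theorems.ManinLocalTwoThreeManinPrimeToAdditiveFiveLeReducibleTwistTransport
import Summits.BirchSwinnertonDyer.Rank1Residual.Additive.GordManinConstantTwistDegree
import HarnessLib

/-!
# Route `ManinLocalTwoThree`, residual crux C5 `ManinPrimeToAdditiveFiveLe`
# (stmt-BirchSwinnertonDyer-22969), line `upper_anchor` (skeleton v11 → v12, registered stub `stub_acrossIsogeny57`):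
# **the orientation law (U) LEAVES the composition path — its two consumers (CORNER(5; II) and the starred
# non-(G)-ordinary rows of the optimal curve) follow from route `TwistFamilyManinDescent`'s K15a
# `SupersingularStrongIsUnstarred` (stmt-BirchSwinnertonDyer-27072) BY NAME, plus K15b (stmt-27071) already in the cone**

Width seat bsd-line-ml23-c5-p1-w2 (gen 5), piece ψ, part 1/2. After the lead's gen-6 moves (skeleton v11, p630701
`…RedFiveSevenStarredOfItems.lean`, p63xxxx `…LedgerByNameOfKato.lean`) the C5 line is a by-name assembly over SEVEN
cite-only prints ∧ stmt-27071 ∧ stmt-27552 ∧ E-imc-5 `OptimalUnstarredAcrossIsogeny 5 ∧ 7` ∧ E-imc-9(13), where E-imc-5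
enters ONLY through law (U) («lattice-optimal ∧ `W[p]`-reducible ∧ not (G)-ordinary ⟹ `ord_p Δ_min ≤ 4`»,
`optimalUnstarredNonGord57_of_acrossIsogeny_of_gealyKlagsbrun`, υ p626338, which also consumes Gealy–Klagsbrun 2017),
and (U) is used at exactly two places: the lead's μ (CORNER(5; II), p623176) and the starred rows `(5;8)`, `(5;10)`,
`(7;9)` of p630701 §2. THIS FILE replaces (U) there by the TFMD item K15a («on the rows `(5; 4/8)`, `(7; 3/9)` with
`p² ∣ N`, `W[p]` reducible and `W ⊗ p*` additive, a lattice-optimal `W` is UNSTARRED»), which part 2/2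
(`…StrongIsUnstarredOfAcrossIsogeny.lean`) shows to be the WEAKER statement (K15a ⟸ modularity ∧ GK ∧ E-imc-5(5) ∧
E-imc-5(7)):

* §0 dictionary: no `Iₙ*` fibre when `0 ≤ ord_p j` and `ord_p Δ_min ≠ 6`; not (G)-ordinary on `(5;8)`, `(5;10)`, `(7;9)`.
* §1 `exists_optimalPartner_pStar_of_row_two_or_ten` — the lead's μ plumbing made reusable: for a twist-minimal
  `W[p]`-reducible `W` on the row `ord_p Δ_min ∈ {2, 10}` (`p ≥ 5`, `p² ∣ N`, `0 ≤ ord_p j`) the lattice-optimal curve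
  `W₀` of the class of `W ⊗ p*` (modularity) has `W ∼ W₀ ⊗ p*`, `p² ∣ N(W₀) = N(W)`, `W₀[p]` reducible, odd
  twist-minimality, and `ord_p Δ_min(W₀) ∈ {4, 8}` (tame-index isogeny invariance along `W₀ ∼ C`, `C` the minimal
  model of `W ⊗ p*`, `ord_p Δ_min(C) ≡ ord_p Δ_min(W) + 6 (mod 12)`).
* §2 `cornerTypeIIAtFive_of_strongIsUnstarred` — **CORNER(5; II) (hypothesis `hB` of p622240, VERBATIM) ⟸ K15a**: the
  starred optimal partner of a type-II curve is on `(5; 8)`, K15a empties that row.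
* §3 `coreRED57starred_of_twistFamilyItems` — **the starred reducible residue at `5, 7` (conclusion of p630701 §2,
  VERBATIM) ⟸ K15b ∧ stmt-27552 ∧ K15a**: rows `(5;9)`, `(7;8)`, `(7;10)` are rows of 27552 (as in p630701); `(5;8)`,
  `(7;9)` are K15a rows of the optimal curve itself; on `(5;10)` (II*, `e = 6`, outside K15a's rows) the optimal
  `χ₅`-partner is on `(5;8)` — empty by K15a — or on `(5;4)`, where the an-cell's irreducibility-free transport
  `c(D) ∣ c(D₀)` (θ, p617000) and K15b give `5 ∤ c(D)`.

NET (with part 2/2): C5 BY NAME ⟸ SIX prints {F″, ČNS, Cremona ≤ 5·10⁵, EdK, EdG, MazurJ} ∧ stmt-27071 ∧ stmt-27552 ∧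
stmt-27072 ∧ `OrdinaryRamifiedTwistLaw 13` — Gealy–Klagsbrun and E-imc-5(5), E-imc-5(7) drop out; the potentially
supersingular ORIENTATION node of C5 is the registered TFMD item K15a (the two books now share 27071, 27552 AND 27072;
census behind K15a, TFMD instrument I6, N < 5·10⁵: 947/947 reducible SS-Raynaud classes have the UNSTARRED twin optimal).
HONEST STATUS: conditional results (`--supports`, helper) on OPEN items (27071, 27552, 27072); nothing here proves C5 or BSD.

References: [EdixhovenManin1991] Thm. 3, Prop. 7, §4; [Stevens1989] §2, (5.2), (5.4); [Pal2012] Prop. 2.5, Lemma 3.1;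
[SerreTate1968] §2 Cor. 3; [SilvermanATAEC1994] IV Table 4.1; [SilvermanAEC2009] VII.5.1, VIII.8.3, X.5.4; [Delbourgo1998] §1.5.
-/

set_option autoImplicit false
-- the Theorems namespace of this sub repeats the summit name by design (D-0017 nested layout)
set_option linter.dupNamespace false

noncomputable section

open scoped Classical NumberField

namespace Summit.BirchSwinnertonDyer.BirchSwinnertonDyer.Theorems

open WeierstrassCurve IsDedekindDomain IsDedekindDomain.HeightOneSpectrum Rat.HeightOneSpectrum NumberField
  Literature.NumberTheory.EllipticCurves Literature.NumberTheory.EllipticCurves.ModularForms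
  Literature.NumberTheory.EllipticCurves.Rank1Residual
  Literature.NumberTheory.DiophantineGeometry
  Summit.BirchSwinnertonDyer.Rank1Residual
  Summit.BirchSwinnertonDyer.Rank1Residual.ManinAdditive
  Summit.BirchSwinnertonDyer.Rank1Residual.Additive

/-! ## §0 Dictionary: a potentially good additive fibre at `p ≥ 5` with `ord_p Δ_min ≠ 6` has no `Iₙ*` -/

/-- **No `Iₙ*` fibre** at an additive `p ≥ 5` with `0 ≤ ord_p j` and `ord_p Δ_min ≠ 6`: `n = 0` would give
`ord_p Δ_min = 6` (Tate's table, `ord_p Δ_min = m_p + 1`), `n ≥ 1` would give `ord_p j < 0`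
(`one_lt_valuation_j_of_kodairaSymbolAt_eq_Istar_succ`). [cite: SilvermanATAEC1994, IV Table 4.1] -/
theorem forall_kodairaSymbolAt_ne_Istar_of_padicValRat_j_nonneg_of_ne_six (W : WeierstrassCurve ℚ) [W.IsElliptic]
    [W.IsGloballyMinimal] (p : ℕ) [hpF : Fact p.Prime] (hp5 : 5 ≤ p) (hadd : Addv W p)
    (hj : 0 ≤ padicValRat p W.j) (h6 : padicValInt p W.minimalDiscriminantInt ≠ 6) :
    ∀ n : ℕ, W.kodairaSymbolAt (placeOf p) ≠ .Istar n := by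
  have hp : p.Prime := hpF.out
  intro n hK
  have hK' : W.kodairaSymbolAt (placeOf p) = .Istar n := hK
  cases n with
  | zero =>
    have h := padicValInt_minimalDiscriminantInt_eq_numComponents_add_one W p hp5 hadd
    rw [hK', KodairaSymbol.numComponents_Istar] at h
    exact h6 (by omega)
  | succ k =>
    haveI : PerfectField (IsLocalRing.ResidueField ((placeOf p).adicCompletionIntegers ℚ)) :=
      PerfectField.ofFinite
    have hchar : ringChar (ℤ ⧸ (placeOf p).asIdeal) ≠ 2 := by
      rw [ringChar_int_quot_placeOf p]; omega
    have h1 := one_lt_valuation_j_of_kodairaSymbolAt_eq_Istar_succ (placeOf p) W hchar hK'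
    have hj0 : W.j ≠ 0 := by
      intro h0
      rw [h0, map_zero] at h1
      exact not_lt.mpr zero_le_one h1
    have hgen : natGenerator (placeOf p) = p :=
      natGenerator_placeOf_eq p
    rw [Rat.HeightOneSpectrum.valuation_eq_exp_neg_padicValRat (placeOf p) hj0,
      hgen, ← WithZero.exp_zero, WithZero.exp_lt_exp] at h1
    linarith

/-- **Not (G)-ordinary on the rows `(5; 8)`, `(5; 10)`, `(7; 9)`**: the tame index `12 / gcd(12, ord_p Δ_min)` is
`3`, `6`, `4`, which does not divide `p − 1` (uniform dictionary `subGord_iff_typeG_of_addv`).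
[cite: SerreTate1968, §2 Cor. 3] [cite: Delbourgo1998, §1.5] -/
theorem not_typeGOrd_of_starred_nonGord_row (W : WeierstrassCurve ℚ) [W.IsElliptic] [W.IsGloballyMinimal]
    {p : ℕ} [Fact p.Prime] (hadd : Addv W p)
    (hrow : (p = 5 ∧ padicValInt p W.minimalDiscriminantInt = 8) ∨
      (p = 5 ∧ padicValInt p W.minimalDiscriminantInt = 10) ∨ (p = 7 ∧ padicValInt p W.minimalDiscriminantInt = 9)) :
    ¬ TypeGOrd W p := by
  intro hG
  have hp2 : p ≠ 2 := by rcases hrow with ⟨rfl, -⟩ | ⟨rfl, -⟩ | ⟨rfl, -⟩ <;> norm_num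
  have hS : SubGord W p := (subGord_iff_typeG_of_addv W p hp2 hadd).mpr hG.typeG
  obtain ⟨-, -, hdvd⟩ := hS
  unfold semistabilityIndex at hdvd
  rcases hrow with ⟨rfl, h⟩ | ⟨rfl, h⟩ | ⟨rfl, h⟩ <;> rw [h] at hdvd <;> norm_num at hdvd

/-- **`W ⊗ χ_{p*}` neither good nor multiplicative at an additive odd `p` ⟹ `0 ≤ ord_p j(W)`** (were `ord_p j < 0`, the
`p*`-twist of the additive potentially multiplicative `W` would be multiplicative at `p`,
`AdditivePotMult.PotMult.mult_quadraticTwist_pStar`; as in `…TwistFamilyManinDescentRaynaudRegimeClassNoLocalPTorsion` §1,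
re-proved to keep this module off that import). [cite: SilvermanATAEC1994, V.5.3] [cite: SilvermanAEC2009, VII.5 Prop. 5.1(b)] -/
theorem padicValRat_j_nonneg_of_addv_of_twist_pStar_not_semistable (W : WeierstrassCurve ℚ) [W.IsElliptic]
    (p : ℕ) [hpF : Fact p.Prime] (hp2 : p ≠ 2) (hadd : Addv W p)
    (htw : ¬ ((W.quadraticTwist (((-1 : ℤ) ^ (p / 2) * p : ℤ) : ℚ)).HasGoodReductionAt
          ((Rat.HeightOneSpectrum.primesEquiv (R := ℤ)).symm ⟨p, hpF.out⟩) ∨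
        (W.quadraticTwist (((-1 : ℤ) ^ (p / 2) * p : ℤ) : ℚ)).HasMultiplicativeReductionAt
          ((Rat.HeightOneSpectrum.primesEquiv (R := ℤ)).symm ⟨p, hpF.out⟩))) :
    0 ≤ padicValRat p W.j := by
  have hp : p.Prime := hpF.out
  by_contra hj
  push Not at hj
  have hpm : AdditivePotMult.PotMult W p := ⟨hadd, hj⟩
  have hm : Mult (W.quadraticTwist ((-1 : ℚ) ^ (p / 2) * p)) p := hpm.mult_quadraticTwist_pStar hp2
  have hcast : (((-1 : ℤ) ^ (p / 2) * p : ℤ) : ℚ) = (-1 : ℚ) ^ (p / 2) * p := by push_cast; ring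
  have hd0 : ((-1 : ℚ) ^ (p / 2) * p) ≠ 0 :=
    mul_ne_zero (pow_ne_zero _ (by norm_num)) (Nat.cast_ne_zero.mpr hp.ne_zero)
  haveI : (W.quadraticTwist ((-1 : ℚ) ^ (p / 2) * p)).IsElliptic := W.isElliptic_quadraticTwist hd0
  have hm' : (W.quadraticTwist ((-1 : ℚ) ^ (p / 2) * p)).HasMultiplicativeReductionAt
      ((Rat.HeightOneSpectrum.primesEquiv (R := ℤ)).symm ⟨p, hp⟩) :=
    ((W.quadraticTwist ((-1 : ℚ) ^ (p / 2) * p)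
      ).hasMultiplicativeReductionAtPrime_iff_hasMultiplicativeReductionAt_holds ⟨p, hp⟩).mp hm
  rw [hcast] at htw
  exact htw (Or.inr hm')

/-! ## §1 The optimal `χ_{p*}`-partner of a curve on the rows `(p; 2)`, `(p; 10)` sits on the row `(p; 4)` or `(p; 8)` -/

/-- **The lattice-optimal `χ_{p*}`-partner of a twist-minimal `W[p]`-reducible curve on the row `ord_p Δ_min ∈ {2, 10}`**
(`p ≥ 5`, `p² ∣ N(W)`, `0 ≤ ord_p j(W)`; modularity for the existence of the optimal curve of the class of `W ⊗ p*`):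
a globally minimal `W₀ ∼ W ⊗ p*` with a lattice-optimal conductor-level datum, `W ∼ W₀ ⊗ p*`, `p² ∣ N(W₀) = N(W)`,
`W₀[p]` reducible, `W₀` twist-minimal at the odd primes, and `ord_p Δ_min(W₀) ∈ {4, 8}` — by the PROVED tame-index
isogeny invariance (`TameDefectIsogenyInvariance`) along `W₀ ∼ C`, `C` the globally minimal model of `W ⊗ p*`, whose
`ord_p Δ_min ≡ ord_p Δ_min(W) + 6 (mod 12)` (`padicValInt_minimalDiscriminantInt_twist_pStar_eq`). Plumbing of the lead's μ
(p623176) made reusable. [cite: SilvermanATAEC1994, IV Table 4.1] [cite: SilvermanAEC2009, VIII.8 Cor. 8.3 and X.5 Cor. 5.4] -/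
theorem exists_optimalPartner_pStar_of_row_two_or_ten (hnf : exists_isNewformOf) {p : ℕ} [hpF : Fact p.Prime]
    (hp5 : 5 ≤ p) (W : WeierstrassCurve ℚ) [W.IsElliptic] [W.IsGloballyMinimal]
    (hpN : p ^ 2 ∣ W.conductorNorm ℤ)
    (hodd : ¬ (∃ (W' : WeierstrassCurve ℚ) (q : ℕ), W'.IsElliptic ∧ W'.IsGloballyMinimal ∧ q.Prime ∧
        q ≠ 2 ∧ q ^ 2 ∣ W.conductorNorm ℤ ∧
        IsIsogenous W (W'.quadraticTwist (((-1 : ℤ) ^ (q / 2) * q : ℤ) : ℚ)) ∧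
        ¬ q ^ 2 ∣ W'.conductorNorm ℤ))
    (hred : ¬ W.HasIrreducibleModPGaloisRep p) (hj : 0 ≤ padicValRat p W.j)
    (hvW : padicValInt p W.minimalDiscriminantInt = 2 ∨ padicValInt p W.minimalDiscriminantInt = 10) :
    ∃ (W₀ : WeierstrassCurve ℚ) (_ : W₀.IsElliptic) (_ : W₀.IsGloballyMinimal) (_ : NeZero (W₀.conductorNorm ℤ))
      (D₀ : ModularParametrizationData W₀ (W₀.conductorNorm ℤ)),
      IsLatticeOptimal D₀ ∧ IsIsogenous (W.quadraticTwist ((((-1 : ℤ) ^ (p / 2) * p : ℤ)) : ℚ)) W₀ ∧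
      IsIsogenous W (W₀.quadraticTwist ((((-1 : ℤ) ^ (p / 2) * p : ℤ)) : ℚ)) ∧
      p ^ 2 ∣ W₀.conductorNorm ℤ ∧ W₀.conductorNorm ℤ = W.conductorNorm ℤ ∧
      ¬ W₀.HasIrreducibleModPGaloisRep p ∧
      ¬ (∃ (W' : WeierstrassCurve ℚ) (q : ℕ), W'.IsElliptic ∧ W'.IsGloballyMinimal ∧ q.Prime ∧
        q ≠ 2 ∧ q ^ 2 ∣ W₀.conductorNorm ℤ ∧
        IsIsogenous W₀ (W'.quadraticTwist (((-1 : ℤ) ^ (q / 2) * q : ℤ) : ℚ)) ∧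
        ¬ q ^ 2 ∣ W'.conductorNorm ℤ) ∧
      (padicValInt p W₀.minimalDiscriminantInt = 4 ∨ padicValInt p W₀.minimalDiscriminantInt = 8) := by
  have hp : p.Prime := hpF.out
  have hp2 : p ≠ 2 := by omega
  obtain ⟨hcast, hd⟩ := pStar_intCast p
  have hd0 : ((((-1 : ℤ) ^ (p / 2) * p : ℤ)) : ℚ) ≠ 0 := by
    push_cast
    exact mul_ne_zero (pow_ne_zero _ (by norm_num)) (by exact_mod_cast hp.ne_zero)
  haveI : (W.quadraticTwist ((((-1 : ℤ) ^ (p / 2) * p : ℤ)) : ℚ)).IsElliptic := W.isElliptic_quadraticTwist hd0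
  have hadd : Addv W p := not_good_and_not_mult_of_sq_dvd_conductorNorm W hpN
  -- the lattice-optimal curve `W₀` of the class of `W ⊗ p*`
  obtain ⟨W₀, hE₀, hM₀, hne₀, D₀, hD₀, hiso⟩ :=
    exists_isIsogenous_latticeOptimal hnf (W.quadraticTwist ((((-1 : ℤ) ^ (p / 2) * p : ℤ)) : ℚ))
  haveI := hE₀
  haveI := hM₀
  haveI := hne₀
  haveI : (W₀.quadraticTwist ((((-1 : ℤ) ^ (p / 2) * p : ℤ)) : ℚ)).IsElliptic := W₀.isElliptic_quadraticTwist hd0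
  haveI : ((W.quadraticTwist ((((-1 : ℤ) ^ (p / 2) * p : ℤ)) : ℚ)).quadraticTwist
      ((((-1 : ℤ) ^ (p / 2) * p : ℤ)) : ℚ)).IsElliptic :=
    (W.quadraticTwist ((((-1 : ℤ) ^ (p / 2) * p : ℤ)) : ℚ)).isElliptic_quadraticTwist hd0
  -- `W ∼ W₀ ⊗ p*`
  have htw : IsIsogenous W (W₀.quadraticTwist ((((-1 : ℤ) ^ (p / 2) * p : ℤ)) : ℚ)) := by
    obtain ⟨Cq, hCq⟩ := W.exists_variableChange_smul_eq_quadraticTwist_sq hd0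
    have h1 : IsIsogenous W ((W.quadraticTwist ((((-1 : ℤ) ^ (p / 2) * p : ℤ)) : ℚ)).quadraticTwist
        ((((-1 : ℤ) ^ (p / 2) * p : ℤ)) : ℚ)) := by
      rw [quadraticTwist_quadraticTwist, ← sq, ← hCq]
      exact isIsogenous_smul _ _
    exact h1.trans' (hiso.quadraticTwist hd0)
  -- twist-minimality of `W` at `p`: `p² ∣ N(W₀)`; hence `N(W₀) = N(W)`
  have hpN₀ : p ^ 2 ∣ W₀.conductorNorm ℤ := by
    by_contra h
    exact hodd ⟨W₀, p, hE₀, hM₀, hp, hp2, hpN, htw, h⟩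
  have hNN : W₀.conductorNorm ℤ = W.conductorNorm ℤ :=
    conductorNorm_eq_of_isIsogenous_twist_pStar_of_sq_dvd hnf hp5 htw hpN hpN₀
  -- the globally minimal model `C` of `W ⊗ p*` (`∼ W₀`): additive, `0 ≤ ord_p j`, `ord_p Δ_min ≡ ord_p Δ_min(W) + 6`
  obtain ⟨u, hCmin⟩ := hasGlobalMinimalModel_rat_holds (W.quadraticTwist ((((-1 : ℤ) ^ (p / 2) * p : ℤ)) : ℚ))
  set C : WeierstrassCurve ℚ := u • W.quadraticTwist ((((-1 : ℤ) ^ (p / 2) * p : ℤ)) : ℚ) with hCdef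
  haveI : C.IsGloballyMinimal := hCmin
  have hCW₀ : IsIsogenous C W₀ :=
    (isIsogenous_smul (W.quadraticTwist ((((-1 : ℤ) ^ (p / 2) * p : ℤ)) : ℚ)) u).symm_of_charZero.trans' hiso
  have hAddC : Addv C p := by
    have hNC : C.conductorNorm ℤ = W₀.conductorNorm ℤ :=
      conductorNorm_eq_of_isIsogenous_of_modularity
        (nonempty_modularParametrizationData_of_exists_isNewformOf hnf
          IsNewformOf.exists_maninConstant_ne_zero_holds) _ _ hCW₀
    exact not_good_and_not_mult_of_sq_dvd_conductorNorm C (by rw [hNC]; exact hpN₀)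
  have hjC : 0 ≤ padicValRat p C.j := by
    have hjCW : C.j = W.j := j_eq_of_smul_quadraticTwist_eq hd0 u hCdef.symm
    rw [hjCW]; exact hj
  have hvC' : (padicValInt p C.minimalDiscriminantInt : ℤ) =
      padicValInt p W.minimalDiscriminantInt + 6 - 12 * padicValRat p (u.u : ℚ) :=
    padicValInt_minimalDiscriminantInt_twist_pStar_eq p W C u (by rw [← hcast])
  obtain ⟨m, hm⟩ : ∃ m : ℤ, padicValRat p (u.u : ℚ) = m := ⟨_, rfl⟩
  rw [hm] at hvC'
  have hmemC := padicValInt_minimalDiscriminantInt_mem_of_addv_of_padicValRat_j_nonneg C p hp5 hAddC hjC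
  have hvC : padicValInt p C.minimalDiscriminantInt = 8 ∨ padicValInt p C.minimalDiscriminantInt = 4 := by
    rcases hvW with h | h <;> rw [h] at hvC' <;>
      rcases hmemC with h' | h' | h' | h' | h' | h' | h' <;> rw [h'] at hvC' ⊢ <;> omega
  -- tame-index invariance along `W₀ ∼ C`: `gcd(12, ord_p Δ_min(W₀)) = gcd(12, ord_p Δ_min(C)) = 4`
  obtain ⟨hadd₀, hj₀⟩ := Addv.of_isIsogenous_of_padicValRat_j_nonneg (p := p) hAddC hjC hCW₀
  have hgcd := TameDefectIsogenyInvariance.gcd_padicValInt_minimalDiscriminantInt_eq_of_isIsogenous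
    (W := W₀) (W' := C) hp5 hj₀ hCW₀.symm_of_charZero
  have h4 : Nat.gcd 12 (padicValInt p W₀.minimalDiscriminantInt) = 4 := by
    rw [← hgcd]
    rcases hvC with h | h <;> rw [h] <;> norm_num
  have h6 : padicValInt p W₀.minimalDiscriminantInt ≠ 6 := by
    intro h; rw [h] at h4; norm_num at h4
  have hI₀ := forall_kodairaSymbolAt_ne_Istar_of_padicValRat_j_nonneg_of_ne_six W₀ p hp5 hadd₀ hj₀ h6
  have hv₀ : padicValInt p W₀.minimalDiscriminantInt = 4 ∨ padicValInt p W₀.minimalDiscriminantInt = 8 := by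
    rcases kodairaSymbolAt_placeOf_cases_of_addv W₀ p hp5 hadd₀ with
      ⟨-, h⟩ | ⟨-, h⟩ | ⟨-, h⟩ | ⟨n, hn, -⟩ | ⟨-, h⟩ | ⟨-, h⟩ | ⟨-, h⟩
    · rw [h] at h4; norm_num at h4
    · rw [h] at h4; norm_num at h4
    · exact Or.inl h
    · exact absurd hn (hI₀ n)
    · exact Or.inr h
    · rw [h] at h4; norm_num at h4
    · rw [h] at h4; norm_num at h4
  -- the transfers along `W ∼ W₀ ⊗ p*`
  have hred₀ : ¬ W₀.HasIrreducibleModPGaloisRep p := fun h ↦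
    not_hasIrreducibleModPGaloisRep_of_isIsogenous htw hred
      ((hasIrreducibleModPGaloisRep_quadraticTwist_iff W₀ hd0 p).mpr h)
  exact ⟨W₀, hE₀, hM₀, hne₀, D₀, hD₀, hiso, htw, hpN₀, hNN, hred₀,
    oddTwistMinimal_of_isIsogenous_twist_pStar hnf hp2 htw hpN hNN hodd, hv₀⟩


/-! ## §2 CORNER(5; II) (registered v7 stub `stub_typeIIAtFiveCorner`, hypothesis `hB` of p622240) from K15a -/

/-- **CORNER(5; II) (hypothesis `hB` of the lead's `coreRED57unstarred_of_cns_of_offTypeIIAtFive_of_typeIIAtFiveCorner`,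
p622240, VERBATIM) ⟸ K15a `SupersingularStrongIsUnstarred` (stmt-27072) BY NAME** — the lead's μ (p623176) with the
orientation law (U) replaced by K15a: the starred lattice-optimal `χ₅`-partner `W₀` of a type-II curve sits on the
row `(5; 8)` (§1), inherits `25 ∣ N`, reducibility and odd twist-minimality (so `W₀ ⊗ 5` is additive), and K15a says
`ord₅ Δ_min(W₀) < 6` — contradiction, the corner is EMPTY. Conditional result on an OPEN item; closes nothing.
[cite: Stevens1989, §2] [cite: SilvermanATAEC1994, IV Table 4.1] -/
theorem cornerTypeIIAtFive_of_strongIsUnstarred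
    (hSU : Summit.BirchSwinnertonDyer.BirchSwinnertonDyer.Theses.TwistFamilyManinDescent.SupersingularStrongIsUnstarred) :
    mazur_not_dvd_maninConstant_of_odd → abbesUllmo_not_dvd_maninConstant_of_not_dvd_level →
    cesnavicius_not_two_dvd_maninConstant_of_two_dvd_level → exists_isNewformOf →
    ∀ (W : WeierstrassCurve ℚ) [W.IsElliptic] [W.IsGloballyMinimal] [NeZero (W.conductorNorm ℤ)]
      (D : ModularParametrizationData W (W.conductorNorm ℤ)),
      IsLatticeOptimal D → ∀ (p : ℕ) (hp : p.Prime), (p = 5 ∨ p = 7) → p ^ 2 ∣ W.conductorNorm ℤ →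
      ¬ (∃ (W' : WeierstrassCurve ℚ) (q : ℕ), W'.IsElliptic ∧ W'.IsGloballyMinimal ∧ q.Prime ∧
          q ≠ 2 ∧ q ^ 2 ∣ W.conductorNorm ℤ ∧
          IsIsogenous W (W'.quadraticTwist (((-1 : ℤ) ^ (q / 2) * q : ℤ) : ℚ)) ∧
          ¬ q ^ 2 ∣ W'.conductorNorm ℤ) →
      ¬ (∃ (W' : WeierstrassCurve ℚ) (d : ℤ), W'.IsElliptic ∧ W'.IsGloballyMinimal ∧
          (d = -1 ∨ d = 2 ∨ d = -2) ∧ 2 ^ 2 ∣ W.conductorNorm ℤ ∧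
          IsIsogenous W (W'.quadraticTwist (d : ℚ)) ∧ ¬ 2 ^ 2 ∣ W'.conductorNorm ℤ) →
      ¬ W.HasIrreducibleModPGaloisRep p →
      500000 < W.conductorNorm ℤ →
      p ∣ D.modularDegree →
      (∀ n : ℕ, W.kodairaSymbolAt ((Rat.HeightOneSpectrum.primesEquiv (R := ℤ)).symm ⟨p, hp⟩) ≠
        .Istar n) →
      padicValInt p W.minimalDiscriminantInt ≤ 4 →
      p = 5 → padicValInt p W.minimalDiscriminantInt = 2 →
      (∀ (W₀ : WeierstrassCurve ℚ) [W₀.IsElliptic] [W₀.IsGloballyMinimal] [NeZero (W₀.conductorNorm ℤ)]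
          (D₀ : ModularParametrizationData W₀ (W₀.conductorNorm ℤ)), IsLatticeOptimal D₀ →
          IsIsogenous (W.quadraticTwist ((((-1 : ℤ) ^ (p / 2) * p : ℤ)) : ℚ)) W₀ →
          4 < padicValInt p W₀.minimalDiscriminantInt) →
      ¬ (p : ℤ) ∣ D.maninConstant := by
  intro _hM _hAU _hC hnf W _ _ _ D _hD p hp _h57 hpN hodd _hdy hred _hN _hdeg _hI _hv hp5 hv2 hall
  haveI hpF : Fact p.Prime := ⟨hp⟩
  have h5 : 5 ≤ p := by omega
  have hp2 : p ≠ 2 := by omega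
  have hadd : Addv W p := not_good_and_not_mult_of_sq_dvd_conductorNorm W hpN
  have hj : 0 ≤ padicValRat p W.j :=
    padicValRat_j_nonneg_of_addv_of_twist_pStar_not_semistable W p hp2 hadd
      (quadraticTwist_pStar_additive_of_twistMinimal W hp hp2 hpN hodd)
  obtain ⟨W₀, hE₀, hM₀, hne₀, D₀, hD₀, hiso, -, hpN₀, -, hred₀, hodd₀, hv₀⟩ :=
    exists_optimalPartner_pStar_of_row_two_or_ten hnf h5 W hpN hodd hred hj (Or.inl hv2)
  haveI := hE₀; haveI := hM₀; haveI := hne₀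
  have hv₀4 : 4 < padicValInt p W₀.minimalDiscriminantInt := hall W₀ D₀ hD₀ hiso
  have hv₀8 : padicValInt p W₀.minimalDiscriminantInt = 8 := by omega
  have htw₀ := quadraticTwist_pStar_additive_of_twistMinimal W₀ hp hp2 hpN₀ hodd₀
  subst hp5
  have hlt := hSU W₀ D₀ 5 hp (Or.inl ⟨rfl, by simp [hv₀8]⟩) hpN₀ hred₀ htw₀ hD₀
  intro _
  omega

/-! ## §3 The STARRED reducible residue at `5, 7` from stmt-27071 ∧ stmt-27552 ∧ K15a — (U) not used -/

/-- **The starred `W[p]`-reducible residue at `p ∈ {5, 7}` (all RED(57♯) cuts, `4 < ord_p Δ_min`; the shape of the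
lead's `coreRED57starred_of_ordinaryCorner_of_optimalUnstarredNonGord`, p630701, VERBATIM) ⟸ K15b
`SupersingularUnstarredStrongManinUnit` (stmt-27071) ∧ `OrdinaryCornerManinResidual` (stmt-27552) ∧ K15a
`SupersingularStrongIsUnstarred` (stmt-27072), all BY NAME.** Ogg–Tate rows: `(5;9)`, `(7;8)`, `(7;10)` are rows of
27552 (as in p630701); `(5;8)`, `(7;9)` are K15a rows of the optimal curve itself — empty; `(5;10)` (II*, `e = 6`):
its lattice-optimal `χ₅`-partner `W₀` is on `(5;8)` — empty by K15a — or on `(5;4)`, and then the an-cell's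
irreducibility-free Manin transport `c(D) ∣ c(D₀)` (θ, p617000) and K15b on `W₀` give `5 ∤ c(D)`. No orientation law
(U) / E-imc-5, no Gealy–Klagsbrun, no Dokchitser–Dokchitser, no ČNS. Conditional result on OPEN items; closes nothing.
[cite: EdixhovenManin1991, Thm. 3 and Prop. 7] [cite: Stevens1989, Lemmas (5.2), (5.4)] [cite: SilvermanATAEC1994, IV Table 4.1] -/
theorem coreRED57starred_of_twistFamilyItems
    (hSS : Summit.BirchSwinnertonDyer.BirchSwinnertonDyer.Theses.TwistFamilyManinDescent.SupersingularUnstarredStrongManinUnit)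
    (hOrd : Summit.BirchSwinnertonDyer.BirchSwinnertonDyer.Theses.TwistFamilyManinDescent.OrdinaryCornerManinResidual)
    (hSU : Summit.BirchSwinnertonDyer.BirchSwinnertonDyer.Theses.TwistFamilyManinDescent.SupersingularStrongIsUnstarred) :
    mazur_not_dvd_maninConstant_of_odd → abbesUllmo_not_dvd_maninConstant_of_not_dvd_level →
    cesnavicius_not_two_dvd_maninConstant_of_two_dvd_level → exists_isNewformOf →
    ∀ (W : WeierstrassCurve ℚ) [W.IsElliptic] [W.IsGloballyMinimal] [NeZero (W.conductorNorm ℤ)]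
      (D : ModularParametrizationData W (W.conductorNorm ℤ)),
      IsLatticeOptimal D → ∀ (p : ℕ) (hp : p.Prime), (p = 5 ∨ p = 7) → p ^ 2 ∣ W.conductorNorm ℤ →
      ¬ (∃ (W' : WeierstrassCurve ℚ) (q : ℕ), W'.IsElliptic ∧ W'.IsGloballyMinimal ∧ q.Prime ∧
          q ≠ 2 ∧ q ^ 2 ∣ W.conductorNorm ℤ ∧
          IsIsogenous W (W'.quadraticTwist (((-1 : ℤ) ^ (q / 2) * q : ℤ) : ℚ)) ∧
          ¬ q ^ 2 ∣ W'.conductorNorm ℤ) →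
      ¬ (∃ (W' : WeierstrassCurve ℚ) (d : ℤ), W'.IsElliptic ∧ W'.IsGloballyMinimal ∧
          (d = -1 ∨ d = 2 ∨ d = -2) ∧ 2 ^ 2 ∣ W.conductorNorm ℤ ∧
          IsIsogenous W (W'.quadraticTwist (d : ℚ)) ∧ ¬ 2 ^ 2 ∣ W'.conductorNorm ℤ) →
      ¬ W.HasIrreducibleModPGaloisRep p →
      500000 < W.conductorNorm ℤ →
      p ∣ D.modularDegree →
      (∀ n : ℕ, W.kodairaSymbolAt ((Rat.HeightOneSpectrum.primesEquiv (R := ℤ)).symm ⟨p, hp⟩) ≠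
        .Istar n) →
      4 < padicValInt p W.minimalDiscriminantInt →
      ¬ (p : ℤ) ∣ D.maninConstant := by
  intro hM hAU hC hnf W _ _ _ D hD p hp h57 hpN hodd _hdy hred _hN _hdeg hI hv4
  haveI hpF : Fact p.Prime := ⟨hp⟩
  have h5 : 5 ≤ p := by rcases h57 with rfl | rfl <;> norm_num
  have hp2 : p ≠ 2 := by omega
  have hadd : Addv W p := not_good_and_not_mult_of_sq_dvd_conductorNorm W hpN
  have htw := quadraticTwist_pStar_additive_of_twistMinimal W hp hp2 hpN hodd
  obtain ⟨hj, hmem⟩ := padicValRat_j_nonneg_and_mem_of_starred W p h5 hadd hI hv4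
  rcases hmem with h | h | h
  · -- `ord_p Δ_min = 8` (IV*, `e = 3`): at 5 a K15a row of `W` itself — empty; at 7 a row of 27552
    rcases h57 with rfl | rfl
    · have hlt := hSU W D 5 hp (Or.inl ⟨rfl, by simp [h]⟩) hpN hred htw hD
      omega
    · refine hOrd hM hAU hC hnf W D 7 hp (Or.inr rfl) ?_ ?_ hpN hred htw hD
      · rintro (⟨h', -⟩ | ⟨-, h'⟩)
        · norm_num at h'
        · rw [h] at h'
          simp at h'
      · rintro ⟨h', -⟩
        norm_num at h'
  · -- `ord_p Δ_min = 9` (III*, `e = 4`): at 5 a row of 27552; at 7 a K15a row of `W` itself — empty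
    rcases h57 with rfl | rfl
    · refine hOrd hM hAU hC hnf W D 5 hp (Or.inl rfl) ?_ ?_ hpN hred htw hD
      · rintro (⟨-, h'⟩ | ⟨h', -⟩)
        · rw [h] at h'
          simp at h'
        · norm_num at h'
      · rintro ⟨-, h'⟩
        rw [h] at h'
        simp at h'
    · have hlt := hSU W D 7 hp (Or.inr ⟨rfl, by simp [h]⟩) hpN hred htw hD
      omega
  · -- `ord_p Δ_min = 10` (II*, `e = 6`): at 7 a row of 27552; at 5 carried to the optimal `χ₅`-partner
    rcases h57 with rfl | rfl
    · obtain ⟨W₀, hE₀, hM₀, hne₀, D₀, hD₀, -, htw', hpN₀, hNN, hred₀, hodd₀, hv₀⟩ :=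
        exists_optimalPartner_pStar_of_row_two_or_ten hnf h5 W hpN hodd hred hj (Or.inr h)
      haveI := hE₀
      haveI := hM₀
      haveI := hne₀
      have htw₀ := quadraticTwist_pStar_additive_of_twistMinimal W₀ hp hp2 hpN₀ hodd₀
      rcases hv₀ with hv₀ | hv₀
      · -- partner on `(5; 4)` (IV): `c(D) ∣ c(D₀)` (θ) and K15b on `W₀`
        have hdvd := maninConstant_dvd_of_isIsogenous_twist_pStar_of_padicValInt_lt_six hp2 W₀ W D₀ D hD hpN₀
          hNN.symm htw' (by omega)
        have h₀ := hSS hM hAU hC hnf W₀ D₀ 5 hp (Or.inl ⟨rfl, hv₀⟩) hpN₀ hred₀ htw₀ hD₀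
        exact fun h5c ↦ h₀ (h5c.trans hdvd)
      · -- partner on `(5; 8)` (IV*): empty by K15a
        have hlt := hSU W₀ D₀ 5 hp (Or.inl ⟨rfl, by simp [hv₀]⟩) hpN₀ hred₀ htw₀ hD₀
        omega
    · refine hOrd hM hAU hC hnf W D 7 hp (Or.inr rfl) ?_ ?_ hpN hred htw hD
      · rintro (⟨h', -⟩ | ⟨-, h'⟩)
        · norm_num at h'
        · rw [h] at h'
          simp at h'
      · rintro ⟨h', -⟩
        norm_num at h'

end Summit.BirchSwinnertonDyer.BirchSwinnertonDyer.Theorems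

end
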